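import Literature.Computability.Complexity.HarnikRazLowerBound
import Mathlib.Analysis.SpecialFunctions.Pow.NthRootLemmas
import Mathlib.Analysis.SpecialFunctions.Sqrt
import HarnessLib

/-!
# Proof of `cavalar_kumar_rossman` (the `2^{Ω(√n / log n)}` monotone lower bound)

Discharges (D-0014) the named fact `cavalar_kumar_rossman` of `RobustSunflowerBound.lean`
(Cavalar–Kumar–Rossman, Algorithmica 84 (2022), Thm. 2.19): with `T = 60000` and `ε = 1/(8T)`,
for every sufficiently large prime `n`, every circuit over `{∧₂, ∨₂}` computing the Harnik–Raz
function `f_HR^{(c,k)}`, `k = ⌊√n⌋`, `c = ⌊√n⌋ / (T ⌊log₂ n⌋)`, has at least `2^{ε √n / log n}`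
gates. This is the parameter bookkeeping of CKR §2.7 on top of the parametric bound
`CKR.harnikRaz_size_mul_ge` (`HarnikRazLowerBound.lean`), applied with the closure parameter
`ε₁ = n^{-2c}` of CKR (2.1): for large `n` one checks `c ≥ 2`,
`2 B log(c/ε₁) k / n ≤ 1/3` (CKR's choice `T = 18 B`, here with the explicit spread constant
`B = 2000` and crude logarithm estimates), `(k-1)/n ≤ 1/10`, `n^c 2^{-⌈k/2⌉} ≤ 1/10`,
`ε₁ #{A : |A| ≤ c} ≤ ½ 3^{-⌊c/2⌋}`, whence `size ≥ (3/10) 3^{⌊c/2⌋} ≥ 2^{⌊c/2⌋ - 2} ≥ 2^{ε √n/log n}`.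
All thresholds are handled through `q = ⌊n^{1/4}⌋`: `⌊log₂ n⌋ ≤ 8q`, `⌊√n⌋ ≥ q²`.

## References

* B. P. Cavalar, M. Kumar, B. Rossman, *Monotone circuit lower bounds from robust sunflowers*,
  Algorithmica 84 (2022), §2.7, Thm. 2.19 [CavalarKumarRossman2022].
-/

namespace Literature.Computability.Complexity

open Finset Filter Real CKR Literature.Combinatorics.SetFamily

/-! ### Elementary estimates -/

/-- `⌊log₂ n⌋ ≤ 8 ⌊n^{1/4}⌋` for `n ≥ 1`. [folklore] -/
theorem nat_log_two_le_eight_mul_sqrt_sqrt {n : ℕ} (hn : 1 ≤ n) :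
    Nat.log 2 n ≤ 8 * Nat.sqrt (Nat.sqrt n) := by
  set q := Nat.sqrt (Nat.sqrt n) with hq
  have hq1 : 1 ≤ q := by
    rw [hq, Nat.le_sqrt, Nat.le_sqrt]; omega
  -- `n < (q+1)^4 ≤ 2^(4(q+1))`
  have h1 : Nat.sqrt n < (q + 1) * (q + 1) := Nat.lt_succ_sqrt _
  have h2 : n < (Nat.sqrt n + 1) * (Nat.sqrt n + 1) := Nat.lt_succ_sqrt _
  have h3 : n < ((q + 1) * (q + 1)) * ((q + 1) * (q + 1)) :=
    h2.trans_le (Nat.mul_le_mul h1 h1)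
  have h4 : (q + 1) < 2 ^ (q + 1) := Nat.lt_two_pow_self
  have h5 : ((q + 1) * (q + 1)) * ((q + 1) * (q + 1)) ≤ 2 ^ (4 * (q + 1)) := by
    have : ((q + 1) * (q + 1)) * ((q + 1) * (q + 1)) = (q + 1) ^ 4 := by ring
    rw [this, pow_mul']
    exact Nat.pow_le_pow_left h4.le 4
  have h6 : Nat.log 2 n < 4 * (q + 1) := Nat.log_lt_of_lt_pow (by omega) (h3.trans_le h5)
  omega

/-- `log n ≤ 2 ⌊log₂ n⌋ log 2` for `n ≥ 2`. [folklore] -/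
theorem log_le_two_mul_nat_log {n : ℕ} (hn : 2 ≤ n) :
    Real.log n ≤ 2 * Nat.log 2 n * Real.log 2 := by
  have hL : 1 ≤ Nat.log 2 n := Nat.log_pos (by norm_num) hn
  have h1 : n < 2 ^ (Nat.log 2 n + 1) := Nat.lt_pow_succ_log_self (by norm_num) n
  have h2 : (n : ℝ) < (2 : ℝ) ^ (Nat.log 2 n + 1) := by exact_mod_cast h1
  have h3 : Real.log n < (Nat.log 2 n + 1 : ℕ) * Real.log 2 := by
    rw [← Real.log_pow]
    exact Real.log_lt_log (by positivity) h2
  have hL' : ((Nat.log 2 n + 1 : ℕ) : ℝ) ≤ 2 * Nat.log 2 n := by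
    have : (1 : ℝ) ≤ Nat.log 2 n := by exact_mod_cast hL
    push_cast; linarith
  have hlog2 : 0 < Real.log 2 := Real.log_pos one_lt_two
  nlinarith

/-- `⌊log₂ n⌋ log 2 ≤ log n` for `n ≥ 1`. [folklore] -/
theorem nat_log_mul_log_two_le {n : ℕ} (hn : 1 ≤ n) : Nat.log 2 n * Real.log 2 ≤ Real.log n := by
  have h1 : 2 ^ Nat.log 2 n ≤ n := Nat.pow_log_le_self 2 (by omega)
  have h2 : ((2 : ℝ) ^ Nat.log 2 n) ≤ n := by exact_mod_cast h1
  rw [← Real.log_pow]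
  exact Real.log_le_log (by positivity) h2

/-- `3^c ≥ 2 (c + 1)` for `c ≥ 2`. [folklore] -/
theorem two_mul_succ_le_three_pow {c : ℕ} (hc : 2 ≤ c) : 2 * (c + 1) ≤ 3 ^ c := by
  induction c, hc using Nat.le_induction with
  | base => norm_num
  | succ m _ ih => rw [pow_succ]; omega

/-- The number of subsets of size `≤ c` of a nonempty `n`-set is at most `(c+1) n^c`. [folklore] -/
theorem card_filter_card_le_le {α : Type*} [Fintype α] [DecidableEq α] (hα : 0 < Fintype.card α)
    (c : ℕ) : #(univ.filter fun A : Finset α => #A ≤ c) ≤ (c + 1) * Fintype.card α ^ c := by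
  have hcover : (univ.filter fun A : Finset α => #A ≤ c)
      ⊆ (range (c + 1)).biUnion fun j => powersetCard j (univ : Finset α) := by
    intro A hA
    have h := (mem_filter.1 hA).2
    exact mem_biUnion.2 ⟨#A, mem_range.2 (by omega), mem_powersetCard.2 ⟨subset_univ A, rfl⟩⟩
  calc #(univ.filter fun A : Finset α => #A ≤ c)
      ≤ ∑ j ∈ range (c + 1), #(powersetCard j (univ : Finset α)) :=
        (card_le_card hcover).trans card_biUnion_le
    _ ≤ ∑ _j ∈ range (c + 1), Fintype.card α ^ c := by
        refine sum_le_sum fun j hj => ?_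
        rw [card_powersetCard, card_univ]
        exact (Nat.choose_le_pow _ _).trans (Nat.pow_le_pow_right hα (by rw [mem_range] at hj; omega))
    _ = (c + 1) * Fintype.card α ^ c := by rw [sum_const, card_range, smul_eq_mul]

/-! ### The discharge -/

/-- **Cavalar–Kumar–Rossman, Thm. 2.19** (`cavalar_kumar_rossman` holds): with `T = 60000` and
`ε = 1/480000`, for all sufficiently large primes `n` every monotone circuit computing
`f_HR^{(c,k)}`, `k = ⌊√n⌋`, `c = ⌊√n⌋/(T ⌊log₂ n⌋)`, has at least `2^{ε √n / log n}` gates.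
[cite: CavalarKumarRossman2022, Thm. 2.19] -/
theorem cavalar_kumar_rossman_holds : cavalar_kumar_rossman := by
  obtain ⟨T, hT⟩ : ∃ T : ℕ, T = 60000 := ⟨_, rfl⟩
  have hTpos : 0 < T := by rw [hT]; norm_num
  have hT16 : 16 ≤ T := by rw [hT]; norm_num
  have hTR : (T : ℝ) = 60000 := by rw [hT]; norm_num
  refine ⟨T, hTpos, 1 / (8 * T), by positivity, ?_⟩
  rw [eventually_atTop]
  refine ⟨(200 * T) ^ 4, fun n hn hprime C hC hf => ?_⟩
  haveI : Fact n.Prime := ⟨hprime⟩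
  have hn3 : 3 ≤ n := le_trans (by rw [hT]; norm_num) hn
  have hn9 : 9 ≤ n := le_trans (by rw [hT]; norm_num) hn
  -- notation
  set k := Nat.sqrt n with hk
  set L := Nat.log 2 n with hL
  set c := k / (T * L) with hc
  set q := Nat.sqrt (Nat.sqrt n) with hq
  -- basic natural-number facts
  have hn2 : 2 ≤ n := hprime.two_le
  have hq200 : 200 * T ≤ q := by
    rw [hq, Nat.le_sqrt, Nat.le_sqrt]
    calc 200 * T * (200 * T) * (200 * T * (200 * T)) = (200 * T) ^ 4 := by ring
      _ ≤ n := hn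
  have hqk : q * q ≤ k := by rw [hk, ← Nat.le_sqrt]
  have hkn2 : k * k ≤ n := Nat.sqrt_le n
  have hnk : n < (k + 1) * (k + 1) := Nat.lt_succ_sqrt n
  have hL1 : 1 ≤ L := Nat.log_pos (by norm_num) hn2
  have hL8 : L ≤ 8 * q := nat_log_two_le_eight_mul_sqrt_sqrt (by omega)
  have hkq : 1 ≤ q := le_trans (by omega) hq200
  -- `c ≥ q / (8T) ≥ 25`
  have hc_ge : q / (8 * T) ≤ c := by
    rw [hc]
    calc q / (8 * T) = q * q / (8 * T * q) := by
          rw [show 8 * T * q = q * (8 * T) by ring, Nat.mul_div_mul_left _ _ (by omega)]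
      _ ≤ k / (8 * T * q) := Nat.div_le_div_right hqk
      _ ≤ k / (T * L) := Nat.div_le_div_left
          (calc T * L ≤ T * (8 * q) := Nat.mul_le_mul_left T hL8
            _ = 8 * T * q := by ring) (by positivity)
  have hc25 : 25 ≤ c := le_trans (by
    calc 25 = 200 * T / (8 * T) := by
          rw [show 200 * T = 25 * (8 * T) by ring, Nat.mul_div_cancel _ (by omega)]
      _ ≤ q / (8 * T) := Nat.div_le_div_right hq200) hc_ge
  have hc2 : 2 ≤ c := by omega
  have hk1 : 1 ≤ k := le_trans (Nat.one_le_iff_ne_zero.2 (by positivity)) hqk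
  have hkn : k < n := Nat.sqrt_lt_self hprime.one_lt
  have hcTL : c * (T * L) ≤ k := Nat.div_mul_le_self k (T * L)
  -- real versions
  have hnR : (2 : ℝ) ≤ n := by exact_mod_cast hn2
  have hn0 : (0 : ℝ) < n := by linarith
  have hkR : (1 : ℝ) ≤ k := by exact_mod_cast hk1
  have hLR : (1 : ℝ) ≤ L := by exact_mod_cast hL1
  have hlog2 := Real.log_two_gt_d9
  have hlog2' := Real.log_two_lt_d9
  have hlogn_le : Real.log n ≤ 2 * L * Real.log 2 := log_le_two_mul_nat_log hn2
  have hlogn_ge : L * Real.log 2 ≤ Real.log n := nat_log_mul_log_two_le (by omega)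
  have hlogn1 : 1 ≤ Real.log n := by
    rw [← Real.log_exp 1]
    refine Real.log_le_log (Real.exp_pos 1) ?_
    have := Real.exp_one_lt_d9
    have h3 : (3 : ℝ) ≤ n := by exact_mod_cast hn3
    linarith
  have hcL : (c : ℝ) * L ≤ k / T := by
    rw [le_div_iff₀ (by rw [hTR]; norm_num)]
    have : ((c * (T * L) : ℕ) : ℝ) ≤ k := by exact_mod_cast hcTL
    push_cast at this
    calc (c : ℝ) * L * T = c * (T * L) := by ring
      _ ≤ k := this
  -- the closure parameter `ε₁ = n^{-2c}`
  set ε₁ : ℝ := (1 / n : ℝ) ^ (2 * c) with hε₁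
  have hε₁0 : 0 < ε₁ := by positivity
  have hε₁1 : ε₁ ≤ 1 / 2 := by
    calc ε₁ ≤ (1 / n : ℝ) ^ 1 := pow_le_pow_of_le_one (by positivity)
          (by rw [div_le_one hn0]; linarith) (by omega)
      _ ≤ 1 / 2 := by rw [pow_one]; exact div_le_div_of_nonneg_left (by norm_num) (by norm_num) hnR
  -- `c log n ≤ 2 k log 2 / T`
  have hclogn : (c : ℝ) * Real.log n ≤ 2 * k * Real.log 2 / T := by
    calc (c : ℝ) * Real.log n ≤ c * (2 * L * Real.log 2) :=
          mul_le_mul_of_nonneg_left hlogn_le (by positivity)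
      _ = 2 * Real.log 2 * (c * L) := by ring
      _ ≤ 2 * Real.log 2 * (k / T) := mul_le_mul_of_nonneg_left hcL (by positivity)
      _ = 2 * k * Real.log 2 / T := by ring
  -- the parameter hypothesis `2 B log(c/ε₁) k/n ≤ 1/3`
  have hH : 2 * spreadConst * Real.log (c / ε₁) * k / n ≤ 1 / 3 := by
    have hc0 : (0 : ℝ) < c := by exact_mod_cast (show 0 < c by omega)
    have hlogcε : Real.log (c / ε₁) = Real.log c + 2 * c * Real.log n := by
      rw [Real.log_div hc0.ne' hε₁0.ne', hε₁, Real.log_pow, one_div, Real.log_inv]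
      push_cast; ring
    have hlogc : Real.log c ≤ c * Real.log n := by
      have h1 : Real.log c ≤ c := (Real.log_le_sub_one_of_pos hc0).trans (by linarith)
      exact h1.trans (le_mul_of_one_le_right hc0.le hlogn1)
    have hB : spreadConst = 2000 := rfl
    rw [hlogcε, hB, div_le_iff₀ hn0]
    have hk2n : (k : ℝ) * k ≤ n := by exact_mod_cast hkn2
    have hk0 : (0 : ℝ) ≤ k := by positivity
    -- `2·2000·(3 c log n)·k ≤ 12000 · (2 k log 2 / T) · k ≤ n/3`
    have h1 : (Real.log c + 2 * c * Real.log n) ≤ 3 * (c * Real.log n) := by linarith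
    calc 2 * 2000 * (Real.log c + 2 * c * Real.log n) * k
        ≤ 2 * 2000 * (3 * (c * Real.log n)) * k := by
          exact mul_le_mul_of_nonneg_right (mul_le_mul_of_nonneg_left h1 (by norm_num)) hk0
      _ ≤ 2 * 2000 * (3 * (2 * k * Real.log 2 / T)) * k := by
          exact mul_le_mul_of_nonneg_right (mul_le_mul_of_nonneg_left
            (mul_le_mul_of_nonneg_left hclogn (by norm_num)) (by norm_num)) hk0
      _ = (24000 * Real.log 2 / T) * (k * k) := by ring
      _ ≤ (24000 * Real.log 2 / T) * n := mul_le_mul_of_nonneg_left hk2n (by positivity)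
      _ ≤ 1 / 3 * n := by
          refine mul_le_mul_of_nonneg_right ?_ hn0.le
          rw [hTR, div_le_iff₀ (by norm_num)]
          linarith
  -- the parametric bound
  have hmain := harnikRaz_size_mul_ge hc2 hk1 hkn hε₁0 hε₁1 hH C hC hf
  -- `(k-1)/n ≤ 1/10`
  have hF3 : (k - 1 : ℝ) / n ≤ 1 / 10 := by
    rw [div_le_iff₀ hn0]
    have hk10 : (10 : ℝ) ≤ k := by
      have : 10 ≤ k := le_trans (le_trans (by omega) hq200) ((Nat.le_mul_self q).trans hqk)
      exact_mod_cast this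
    have hk2n : (k : ℝ) * k ≤ n := by exact_mod_cast hkn2
    have : (10 : ℝ) * k ≤ k * k := mul_le_mul_of_nonneg_right hk10 (by positivity)
    linarith
  -- `n^c 2^{-⌈k/2⌉} ≤ 1/10`
  have hF4 : (n : ℝ) ^ c * (1 / 2 : ℝ) ^ ((k + 1) / 2) ≤ 1 / 10 := by
    -- in `ℕ`: `10 n^c ≤ 2^{(k+1)/2}` since `n^c < 2^{(L+1)c} ≤ 2^{2Lc}` and `4Lc + 9 ≤ k`
    have h1 : n ^ c < 2 ^ ((L + 1) * c) := by
      rw [pow_mul]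
      exact Nat.pow_lt_pow_left (Nat.lt_pow_succ_log_self (by norm_num) n) (by omega)
    have h2 : (L + 1) * c ≤ 2 * L * c := Nat.mul_le_mul_right _ (by omega)
    have h4 : 2 * L * c + 4 ≤ (k + 1) / 2 := by
      have : 8 * (2 * L * c) ≤ k :=
        calc 8 * (2 * L * c) = 16 * (L * c) := by ring
          _ ≤ T * (L * c) := Nat.mul_le_mul_right _ hT16
          _ = c * (T * L) := by ring
          _ ≤ k := hcTL
      have hk18 : 18 ≤ k :=
        calc 18 ≤ 200 * T := by omega
          _ ≤ q := hq200
          _ ≤ q * q := Nat.le_mul_self q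
          _ ≤ k := hqk
      omega
    have h5 : 10 * n ^ c ≤ 2 ^ ((k + 1) / 2) :=
      calc 10 * n ^ c ≤ 10 * 2 ^ (2 * L * c) :=
            Nat.mul_le_mul_left 10 (h1.le.trans (Nat.pow_le_pow_right (by norm_num) h2))
        _ ≤ 16 * 2 ^ (2 * L * c) := Nat.mul_le_mul_right _ (by norm_num)
        _ = 2 ^ (2 * L * c + 4) := by rw [pow_add, show (2 : ℕ) ^ 4 = 16 by norm_num, mul_comm]
        _ ≤ 2 ^ ((k + 1) / 2) := Nat.pow_le_pow_right (by norm_num) h4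
    have h6 : (10 : ℝ) * n ^ c ≤ (2 : ℝ) ^ ((k + 1) / 2) := by exact_mod_cast h5
    rw [one_div_pow, ← div_eq_mul_one_div, div_le_iff₀ (by positivity)]
    linarith
  -- `ε₁ #{A : |A| ≤ c} ≤ ½ 3^{-c/2}`, so the per-gate error is `≤ 3^{-⌊c/2⌋}`
  have hF6 : ε₁ * #(univ.filter fun A : Finset (ZMod n) => #A ≤ c) ≤ 1 / 2 * (1 / 3 : ℝ) ^ (c / 2) := by
    have hcard := card_filter_card_le_le (α := ZMod n) (by rw [ZMod.card]; exact hprime.pos) c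
    rw [ZMod.card] at hcard
    have hcardR : (#(univ.filter fun A : Finset (ZMod n) => #A ≤ c) : ℝ) ≤ (c + 1) * (n : ℝ) ^ c := by
      exact_mod_cast hcard
    -- `2 (c+1) 3^c ≤ 9^c ≤ n^c`
    have h9 : 2 * (c + 1) * 3 ^ c ≤ n ^ c := by
      calc 2 * (c + 1) * 3 ^ c ≤ 3 ^ c * 3 ^ c := Nat.mul_le_mul_right _ (two_mul_succ_le_three_pow hc2)
        _ = 9 ^ c := by rw [← mul_pow]; norm_num
        _ ≤ n ^ c := Nat.pow_le_pow_left hn9 c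
    have h9R : 2 * ((c : ℝ) + 1) * (3 : ℝ) ^ c ≤ (n : ℝ) ^ c := by exact_mod_cast h9
    have hhalf : (1 / 3 : ℝ) ^ c ≤ (1 / 3 : ℝ) ^ (c / 2) :=
      pow_le_pow_of_le_one (by norm_num) (by norm_num) (Nat.div_le_self c 2)
    have hnc : (0 : ℝ) < (n : ℝ) ^ c := by positivity
    calc ε₁ * #(univ.filter fun A : Finset (ZMod n) => #A ≤ c)
        ≤ ε₁ * ((c + 1) * (n : ℝ) ^ c) := mul_le_mul_of_nonneg_left hcardR hε₁0.le
      _ = (c + 1) / (n : ℝ) ^ c := by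
          rw [hε₁, one_div_pow, mul_comm 2 c, pow_mul, pow_two]
          field_simp
      _ ≤ 1 / 2 * (1 / 3 : ℝ) ^ c := by
          rw [div_le_iff₀ hnc, one_div_pow]
          have h3c : (0 : ℝ) < (3 : ℝ) ^ c := by positivity
          rw [show 1 / 2 * (1 / (3 : ℝ) ^ c) * (n : ℝ) ^ c = (n : ℝ) ^ c / (2 * (3 : ℝ) ^ c) by ring,
            le_div_iff₀ (by positivity)]
          calc ((c : ℝ) + 1) * (2 * (3 : ℝ) ^ c) = 2 * ((c : ℝ) + 1) * (3 : ℝ) ^ c := by ring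
            _ ≤ (n : ℝ) ^ c := h9R
      _ ≤ 1 / 2 * (1 / 3 : ℝ) ^ (c / 2) := by linarith
  -- hence `3/10 ≤ size · 3^{-⌊c/2⌋}`
  have hsize : 3 / 10 ≤ (C.size : ℝ) * (1 / 3 : ℝ) ^ (c / 2) := by
    have h1 : 3 / 10 ≤ (C.size : ℝ) * (1 / 2 * (1 / 3 : ℝ) ^ (c / 2)
        + ε₁ * #(univ.filter fun A : Finset (ZMod n) => #A ≤ c)) := by linarith
    refine h1.trans ?_
    have hs0 : (0 : ℝ) ≤ C.size := Nat.cast_nonneg _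
    calc (C.size : ℝ) * (1 / 2 * (1 / 3 : ℝ) ^ (c / 2) + ε₁ * #(univ.filter fun A : Finset (ZMod n) => #A ≤ c))
        ≤ (C.size : ℝ) * (1 / 2 * (1 / 3 : ℝ) ^ (c / 2) + 1 / 2 * (1 / 3 : ℝ) ^ (c / 2)) :=
          mul_le_mul_of_nonneg_left (by linarith [hF6]) hs0
      _ = (C.size : ℝ) * (1 / 3 : ℝ) ^ (c / 2) := by ring
  -- the target exponent: `ε √n / log n ≤ ⌊c/2⌋ - 2`
  set h := c / 2 with hh
  have hexp : 1 / (8 * (T : ℝ)) * Real.sqrt n / Real.log n ≤ (h : ℝ) - 2 := by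
    have hsqrt : Real.sqrt n ≤ k + 1 := by
      have := Real.real_sqrt_lt_nat_sqrt_succ (a := n)
      rw [hk]; linarith
    have hhc : ((c : ℝ) - 1) / 2 ≤ h := by
      have : c ≤ 2 * h + 1 := by omega
      have : (c : ℝ) ≤ 2 * h + 1 := by exact_mod_cast this
      linarith
    have hTL0 : 0 < T * L := by positivity
    have hTLR : (0 : ℝ) < (T : ℝ) * L := by positivity
    have hck : (k : ℝ) / (T * L) - 1 ≤ c := by
      have h1 : k < T * L * (c + 1) := by rw [hc]; exact Nat.lt_mul_div_succ k hTL0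
      have h2 : (k : ℝ) < (T : ℝ) * L * (c + 1) := by exact_mod_cast h1
      rw [sub_le_iff_le_add, div_le_iff₀ hTLR]
      linarith
    have hlogpos : 0 < Real.log n := by linarith
    have hqR : 200 * (T : ℝ) * q ≤ k := by
      have : 200 * T * q ≤ k := le_trans (Nat.mul_le_mul_right q hq200) hqk
      exact_mod_cast this
    have hlognq : Real.log n ≤ 12 * q := by
      have hL8R : (L : ℝ) ≤ 8 * q := by exact_mod_cast hL8
      have : (L : ℝ) * Real.log 2 ≤ (8 * q) * 0.6931471808 :=
        mul_le_mul hL8R hlog2'.le (Real.log_pos one_lt_two).le (by positivity)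
      linarith
    -- `(k+1) + 24 T log n ≤ 4 k log 2`
    have e0 : (k : ℝ) + 1 + 24 * T * Real.log n ≤ 4 * k * Real.log 2 := by
      have hk4 : (4 : ℝ) ≤ k := by
        have : 4 ≤ k := le_trans (le_trans (by omega) hq200) ((Nat.le_mul_self q).trans hqk)
        exact_mod_cast this
      have f1 : 24 * (T : ℝ) * Real.log n ≤ 24 * T * (12 * q) :=
        mul_le_mul_of_nonneg_left hlognq (by positivity)
      have f2 : 4 * (k : ℝ) * 0.6931471803 ≤ 4 * k * Real.log 2 :=
        mul_le_mul_of_nonneg_left hlog2.le (by positivity)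
      linarith
    have e1 : 1 / (8 * (T : ℝ)) * Real.sqrt n / Real.log n ≤ (k + 1) / (8 * T * Real.log n) := by
      rw [div_le_div_iff₀ hlogpos (by positivity)]
      have : 1 / (8 * (T : ℝ)) * Real.sqrt n * (8 * T * Real.log n) = Real.sqrt n * Real.log n := by
        field_simp
      rw [this]
      exact mul_le_mul_of_nonneg_right hsqrt hlogpos.le
    have e2 : ((k : ℝ) + 1) / (8 * T * Real.log n) ≤ k * Real.log 2 / (2 * T * Real.log n) - 3 := by
      have : ((k : ℝ) + 1) / (8 * T * Real.log n) ≤ (4 * k * Real.log 2 - 24 * T * Real.log n) / (8 * T * Real.log n) :=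
        div_le_div_of_nonneg_right (by linarith) (by positivity)
      refine this.trans (le_of_eq ?_)
      field_simp
      ring
    have e3 : (k : ℝ) * Real.log 2 / (2 * T * Real.log n) ≤ k / (2 * (T * L)) := by
      rw [div_le_div_iff₀ (by positivity) (by positivity)]
      have := mul_le_mul_of_nonneg_left hlogn_ge (by positivity : (0 : ℝ) ≤ 2 * k * T)
      calc (k : ℝ) * Real.log 2 * (2 * (T * L)) = 2 * k * T * (L * Real.log 2) := by ring
        _ ≤ 2 * k * T * Real.log n := this
        _ = k * (2 * T * Real.log n) := by ring
    have e4 : (k : ℝ) / (2 * (T * L)) - 1 ≤ h := by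
      have : (k : ℝ) / (2 * (T * L)) = (k / (T * L)) / 2 := by field_simp
      rw [this]
      linarith
    linarith
  -- conclusion: `2^{ε √n / log n} ≤ 2^{h-2} = 2^h/4 ≤ (3/10) 3^h ≤ size`
  have hpow : (2 : ℝ) ^ (1 / (8 * (T : ℝ)) * Real.sqrt n / Real.log n) ≤ (2 : ℝ) ^ ((h : ℝ) - 2) :=
    Real.rpow_le_rpow_of_exponent_le one_le_two hexp
  have h2h : (2 : ℝ) ^ ((h : ℝ) - 2) = (2 : ℝ) ^ h / 4 := by
    rw [Real.rpow_sub two_pos, Real.rpow_natCast, Real.rpow_two]; norm_num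
  have h3h : (3 / 10 : ℝ) * (3 : ℝ) ^ h ≤ C.size := by
    have h13 : (1 / 3 : ℝ) ^ h * (3 : ℝ) ^ h = 1 := by rw [← mul_pow]; norm_num
    have := mul_le_mul_of_nonneg_right hsize (by positivity : (0 : ℝ) ≤ (3 : ℝ) ^ h)
    rw [mul_assoc, h13, mul_one] at this
    linarith
  have h23 : (2 : ℝ) ^ h / 4 ≤ 3 / 10 * (3 : ℝ) ^ h := by
    have : (2 : ℝ) ^ h ≤ (3 : ℝ) ^ h := pow_le_pow_left₀ (by norm_num) (by norm_num) h
    linarith [pow_nonneg (show (0 : ℝ) ≤ 2 by norm_num) h]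
  calc (2 : ℝ) ^ (1 / (8 * (T : ℝ)) * Real.sqrt n / Real.log n) ≤ (2 : ℝ) ^ ((h : ℝ) - 2) := hpow
    _ = (2 : ℝ) ^ h / 4 := h2h
    _ ≤ 3 / 10 * (3 : ℝ) ^ h := h23
    _ ≤ C.size := h3h

end Literature.Computability.Complexity
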